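import Summits.Ventures.CertifiedManyBodySolver.Downfold.BoxesHg1201ULadderCensus
import Summits.Ventures.CertifiedManyBodySolver.Downfold.BoxesHg1201TpLadderRungs
import Summits.Ventures.CertifiedManyBodySolver.Downfold.BoxesLa214ELadderMembership
import Summits.Ventures.CertifiedManyBodySolver.Observables.RungLeavesCoverageHg1201P10
import HarnessLib

/-!
# The U-direction ladder of Hg-1201, part 6: THE LADDER LANDS IN THE BOX — every admitted object-E determination of HgBa₂CuO₄₊δ
# is a POINT of the typed boxes, @0 (columns M19b / M19, v1.13 re-issues and boxes of record) and @10 GPa (`boxHg1201E_M19P10uRnR`)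

Venture CertifiedManyBodySolver, cell `pub/hubbard-downfold` (MO-S1 → S2 seam; D-0154 (1)(C) COVERAGE (ii) Hg-1201), seat `hubbard-cov-hg1201-unc-1`
(lane U MEMBERS + QUOTIENT; rulings R-mb (b), R-mc (a)(b), R-me (a), R-mg (e)). The Hg-1201 twin of the La₂CuO₄ TEMPLATE `BoxesLa214ELadderMembership`
§6 (START-HERE §7 (ii): «the uncertainty-ladder template to copy»), reusing its generic `oneBandPointE` / `oneBandBox_mem_iff_of_accessors` by import (no
restatement). Parts 1–5 of this lane: `BoxesHg1201ULadder` (members, hulls, quotient rows, v1.13 re-issues; p607319), `…ULadderWords` (words, leaf transfers,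
slabs; p607849), `…ULadderP` (pressure leg, `boxHg1201E_M19P10uRnR`; p608455 / p611489), `…MULadder` (object M, `r₁`; p610962), `…ULadderCensus` (banks per
threshold `U†`; p612076). The other two lanes' rungs enter BY NAME (R-ma): `cov-hg1201-unc-2`'s `t_eff` members `hg1201E_tMembers` / the @10 members × INFL-P
(`hg1201E_tP10_inflP_mem_entry`) and filling rows `hg1201E_nP10R` / `hg1201E_nARPES` (`BoxesHg1201ETnLadder{,P10}`), `cov-hg1201-unc-3`'s `t′/t_eff` members
`hg1201E_P0dop_tp_members` (`BoxesHg1201TpLadder`) and current pressure hull `boxHg1201E_M19PHullNR` (`BoxesHg1201TpLadderRungs`). Part 7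
(`BoxesHg1201ELadderWordsDown`) reads the box words down the ladder.

WHAT «CERTIFIED DOWNFOLD ERROR BARS» BUYS A CONSUMER, typed: the composed S2-frame point `(U_abs/t_eff, t′/t_eff, n, t_eff, t″ = 0)` of EVERY admitted
determination (16 one-band `U` members × the `t_eff` entry × the `t′/t_eff` entry × the filling entry) lies in the typed box, so ANY word certified on the box
holds at every rung of the literature / in-house ladder, by `exact` (part 7).

* §L0 point accessors (`oneBandPointE_apply_*`, `rfl`), a generic `Box.mem_withEntry_of_mem`, `hg1201E_tppE_mem_zero`.
* §L1 @0: point membership unfolded on `boxHg1201E_M19buR` / `_M19uR` (v1.13) and on the boxes of record `boxHg1201E_M19b` / `_M19`; THE LADDER LANDS: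
  `U ∈ hg1201U_litHullRu = [2.15, 5.2]` ⇒ point ∈ `…M19buR` (`U/t ∈ [43/12, 52/5] ⊆ [7/2, 52/5]`, part 1 `hg1201E_Ut_mem_uR_U`); `U ∈ hg1201U_litHullV18 =
  [2.15, 4.37]` (15 of the 16 members) ⇒ point ∈ the BOX OF RECORD `…M19b` (`U/t ≤ 437/50 = 8.74 ≤ 44/5`); the R-u member `5.2` lands in the box of record
  iff `t_eff ≥ 13/22 = 0.5909…` (`hg1201E_RuRung_mem_M19b_iff`) — the typed reason part 2's transfer `Hg1201M19b_StiffnessBoxCeiling_of_uR` exists; member /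
  three-ladder list forms (`hg1201U_members_land`, `hg1201E_threeLadders_land_in_M19b`); M19 column twins.
* §L2 @10: every rung (`U ∈ [2.15, 5.2]`, `t_eff ∈ [51/100, 17/25]` — in particular unc-2's members `× e^{±0.038}` —, `t′ ∈ [−49/100, −7/20]`, `n ∈ [79/100, 22/25]`)
  is a point of `boxHg1201E_M19P10uRnR`; the @10 BOX OF RECORD `boxHg1201E_M19P10` (`U/t ≤ 17/2`) MISSES the cGW rung `(4.37 eV, 0.51 eV)` (point form of
  part 1's finding `hg1201E_Ut_P10_corner_not_mem`) but holds every member `≤ 4.029` at every `t_eff @10` (`hg1201E_membersP10_image_le_17o2`);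
  `boxHg1201E_M19P10uRnR ⊆ boxHg1201E_M19PHullNR` (unc-3's generic `withEntry_filling_P10_refines_PHullNR` at unc-2's `hg1201E_nP10R`, one `exact`).

Everything here is PROVED (no `sorry`, no new axiom). HONEST FRAMING: SYSTEMATIC (screening-grade) in-house numbers and [float] literature numbers typed
verbatim from parts 1–5 and the sibling lanes; typing certifies containment arithmetic, nothing about HgBa₂CuO₄₊δ; a member's presence is not an admission
(the lead's R-xx); no word, edge, bar or router token is touched; no summit statement is proved by this file.
-/

noncomputable section

namespace Summit.Ventures.CertifiedManyBodySolver.Downfold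

open Set NonemptyInterval
open Summit.Ventures.CertifiedManyBodySolver.Observables
open Literature.MathematicalPhysics.QuantumLattice

/-! ## §L0 Point accessors and one generic re-issue membership lemma -/

/-- The `U/t` coordinate of an object-E point is the quotient `U / t`. [folklore] -/
@[simp] theorem oneBandPointE_apply_UOverT (U t tp n : ℝ) : oneBandPointE U t tp n .UOverT = U / t := rfl
/-- The `t′/t` coordinate of an object-E point. [folklore] -/
@[simp] theorem oneBandPointE_apply_tpOverT (U t tp n : ℝ) : oneBandPointE U t tp n .tpOverT = tp := rfl
/-- The filling coordinate of an object-E point. [folklore] -/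
@[simp] theorem oneBandPointE_apply_filling (U t tp n : ℝ) : oneBandPointE U t tp n .filling = n := rfl
/-- The `t_eV` coordinate of an object-E point. [folklore] -/
@[simp] theorem oneBandPointE_apply_tEV (U t tp n : ℝ) : oneBandPointE U t tp n .tEV = t := rfl
/-- The `t″/t` coordinate of an object-E point is `0`. [folklore] -/
@[simp] theorem oneBandPointE_apply_tppOverT (U t tp n : ℝ) : oneBandPointE U t tp n .tppOverT = 0 := rfl

/-- **Membership in a one-coordinate re-issue from membership in the base box** (generic): `p ∈ B` and `p i ∈ e` give `p ∈ B.withEntry i e`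
(inward OR outward — the other coordinates are `B`'s own). [folklore] -/
theorem Box.mem_withEntry_of_mem {ι : Type*} [DecidableEq ι] {B : Box ι} {i : ι} {e : Entry} {p : ι → ℝ} (hp : B.Mem p)
    (he : e.Mem (p i)) : (B.withEntry i e).Mem p :=
  (Box.mem_withEntry_iff B i e p).2 ⟨he, fun j _ f hf => hp j f hf⟩

/-- The three object-E `t″/t = 0` entries contain `0`. [folklore] -/
theorem hg1201E_tppE_mem_zero : hg1201E_M19b_tpp.Mem 0 ∧ hg1201E_M19_tpp.Mem 0 ∧ hg1201E_M19P10_tpp.Mem 0 := by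
  refine ⟨?_, ?_, ?_⟩ <;> exact (Entry.mem_ofEnds_iff _ _ _ _ _).2 ⟨by norm_num, by norm_num⟩

/-! ## §L1 @0: point membership unfolded, and THE LADDER LANDS IN THE BOX -/

/-- **An object-E point in the v1.13 box `boxHg1201E_M19buR`, unfolded**: `U/t ∈ [7/2, 52/5]`, `t′/t ∈ [−27/50, −43/100]`, `n ∈ [167/200, 183/200]`,
`t ∈ [1/2, 3/5]`. [folklore] -/
theorem oneBandPointE_mem_boxHg1201E_M19buR_iff {U t tp n : ℝ} :
    boxHg1201E_M19buR.Mem (oneBandPointE U t tp n) ↔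
      ((7 / 2 : ℝ) ≤ U / t ∧ U / t ≤ 52 / 5) ∧ ((-27 / 50 : ℝ) ≤ tp ∧ tp ≤ -43 / 100) ∧
      ((167 / 200 : ℝ) ≤ n ∧ n ≤ 183 / 200) ∧ ((1 / 2 : ℝ) ≤ t ∧ t ≤ 3 / 5) := by
  rw [boxHg1201E_M19buR_mem_iff]
  simp only [oneBandPointE_apply_UOverT, oneBandPointE_apply_tpOverT, oneBandPointE_apply_filling, oneBandPointE_apply_tEV,
    oneBandPointE_apply_tppOverT, and_true]

/-- **An object-E point in the v1.13 M19 column `boxHg1201E_M19uR`, unfolded** (`n ∈ [4/5, 22/25]`). [folklore] -/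
theorem oneBandPointE_mem_boxHg1201E_M19uR_iff {U t tp n : ℝ} :
    boxHg1201E_M19uR.Mem (oneBandPointE U t tp n) ↔
      ((7 / 2 : ℝ) ≤ U / t ∧ U / t ≤ 52 / 5) ∧ ((-27 / 50 : ℝ) ≤ tp ∧ tp ≤ -43 / 100) ∧
      ((4 / 5 : ℝ) ≤ n ∧ n ≤ 22 / 25) ∧ ((1 / 2 : ℝ) ≤ t ∧ t ≤ 3 / 5) := by
  rw [boxHg1201E_M19uR_mem_iff]
  simp only [oneBandPointE_apply_UOverT, oneBandPointE_apply_tpOverT, oneBandPointE_apply_filling, oneBandPointE_apply_tEV,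
    oneBandPointE_apply_tppOverT, and_true]

/-- **An object-E point in the BOX OF RECORD `boxHg1201E_M19b`, by entries** (generic accessor lemma of the template). [folklore] -/
theorem oneBandPointE_mem_boxHg1201E_M19b_iff {U t tp n : ℝ} :
    boxHg1201E_M19b.Mem (oneBandPointE U t tp n) ↔
      hg1201E_M19b_U.Mem (U / t) ∧ hg1201E_M19b_tp.Mem tp ∧ hg1201E_M19b_n.Mem n ∧ hg1201E_M19b_t.Mem t := by
  rw [oneBandBox_mem_iff_of_accessors (B := boxHg1201E_M19b) (eU := hg1201E_M19b_U) (eS := hg1201E_M19b_tp) (eN := hg1201E_M19b_n)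
    (eT := hg1201E_M19b_t) (eP := hg1201E_M19b_tpp) rfl rfl rfl rfl rfl rfl rfl rfl rfl rfl]
  simp only [oneBandPointE_apply_UOverT, oneBandPointE_apply_tpOverT, oneBandPointE_apply_filling, oneBandPointE_apply_tEV,
    oneBandPointE_apply_tppOverT]
  exact ⟨fun h => ⟨h.1, h.2.1, h.2.2.1, h.2.2.2.1⟩, fun h => ⟨h.1, h.2.1, h.2.2.1, h.2.2.2, hg1201E_tppE_mem_zero.1⟩⟩

/-- **The same, in real inequalities**: `U/t ∈ [7/2, 44/5]`, `t′/t ∈ [−27/50, −43/100]`, `n ∈ [167/200, 183/200]`, `t ∈ [1/2, 3/5]`. [folklore] -/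
theorem oneBandPointE_mem_boxHg1201E_M19b_iff' {U t tp n : ℝ} :
    boxHg1201E_M19b.Mem (oneBandPointE U t tp n) ↔
      ((7 / 2 : ℝ) ≤ U / t ∧ U / t ≤ 44 / 5) ∧ ((-27 / 50 : ℝ) ≤ tp ∧ tp ≤ -43 / 100) ∧
      ((167 / 200 : ℝ) ≤ n ∧ n ≤ 183 / 200) ∧ ((1 / 2 : ℝ) ≤ t ∧ t ≤ 3 / 5) := by
  rw [oneBandPointE_mem_boxHg1201E_M19b_iff]
  constructor
  · rintro ⟨hU, htp, hn, ht⟩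
    have hU' := (Entry.mem_ofEnds_iff _ _ _ _ _).1 hU
    have htp' := (Entry.mem_ofEnds_iff _ _ _ _ _).1 htp
    have hn' := (Entry.mem_ofEnds_iff _ _ _ _ _).1 hn
    have ht' := (Entry.mem_ofEnds_iff _ _ _ _ _).1 ht
    push_cast at hU' htp' hn' ht'
    exact ⟨hU', htp', hn', ht'⟩
  · rintro ⟨hU, htp, hn, ht⟩
    refine ⟨(Entry.mem_ofEnds_iff _ _ _ _ _).2 ?_, (Entry.mem_ofEnds_iff _ _ _ _ _).2 ?_, (Entry.mem_ofEnds_iff _ _ _ _ _).2 ?_,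
      (Entry.mem_ofEnds_iff _ _ _ _ _).2 ?_⟩ <;> push_cast
    exacts [hU, htp, hn, ht]

/-- **An object-E point in the M19 BOX OF RECORD `boxHg1201E_M19`, by entries.** [folklore] -/
theorem oneBandPointE_mem_boxHg1201E_M19_iff {U t tp n : ℝ} :
    boxHg1201E_M19.Mem (oneBandPointE U t tp n) ↔
      hg1201E_M19_U.Mem (U / t) ∧ hg1201E_M19_tp.Mem tp ∧ hg1201E_M19_n.Mem n ∧ hg1201E_M19_t.Mem t := by
  rw [oneBandBox_mem_iff_of_accessors (B := boxHg1201E_M19) (eU := hg1201E_M19_U) (eS := hg1201E_M19_tp) (eN := hg1201E_M19_n)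
    (eT := hg1201E_M19_t) (eP := hg1201E_M19_tpp) rfl rfl rfl rfl rfl rfl rfl rfl rfl rfl]
  simp only [oneBandPointE_apply_UOverT, oneBandPointE_apply_tpOverT, oneBandPointE_apply_filling, oneBandPointE_apply_tEV,
    oneBandPointE_apply_tppOverT]
  exact ⟨fun h => ⟨h.1, h.2.1, h.2.2.1, h.2.2.2.1⟩, fun h => ⟨h.1, h.2.1, h.2.2.1, h.2.2.2, hg1201E_tppE_mem_zero.2.1⟩⟩

/-- **THE LADDER LANDS IN THE v1.13 BOX (p = ⅛ column)**: every `U ∈ hg1201U_litHullRu = [2.15, 5.2]` eV over every `t_eff ∈ [1/2, 3/5]` eV, at every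
`t′/t_eff ∈ [−27/50, −43/100]` and every `n ∈ [167/200, 183/200]`, composes to a POINT of `boxHg1201E_M19buR` (the quotient step is part 1's
`hg1201E_Ut_mem_uR_U`: `U/t ∈ [43/12, 52/5] ⊆ [7/2, 52/5]`). [folklore] -/
theorem oneBandPointE_mem_boxHg1201E_M19buR_of_ladder {U t tp n : ℝ} (hU : hg1201U_litHullRu.Mem U) (ht : hg1201E_M19b_t.Mem t)
    (htp : hg1201E_M19b_tp.Mem tp) (hn : hg1201E_M19b_n.Mem n) : boxHg1201E_M19buR.Mem (oneBandPointE U t tp n) := by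
  have hU' := (Entry.mem_ofEnds_iff _ _ _ _ _).1 hU
  have ht' := (Entry.mem_ofEnds_iff _ _ _ _ _).1 ht
  have htp' := (Entry.mem_ofEnds_iff _ _ _ _ _).1 htp
  have hn' := (Entry.mem_ofEnds_iff _ _ _ _ _).1 hn
  push_cast at hU' ht' htp' hn'
  have hq := (Entry.mem_ofEnds_iff _ _ _ _ _).1 (hg1201E_Ut_mem_uR_U (U := U) (t := t) ⟨by linarith [hU'.1], hU'.2⟩ ht').1
  push_cast at hq
  exact oneBandPointE_mem_boxHg1201E_M19buR_iff.2 ⟨hq, htp', hn', ht'⟩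

/-- **THE v1.8 LADDER LANDS IN THE BOX OF RECORD**: every `U ∈ hg1201U_litHullV18 = [2.15, 4.37]` eV (15 of the 16 members) over every `t_eff ∈ [1/2, 3/5]`,
at every `t′/t_eff`, `n` of the entries, is a POINT of `boxHg1201E_M19b` (`U/t ≤ 437/50 = 8.74 ≤ 44/5`; part 1's `hg1201E_Ut_mem_M19b_U`). [folklore] -/
theorem oneBandPointE_mem_boxHg1201E_M19b_of_ladder {U t tp n : ℝ} (hU : hg1201U_litHullV18.Mem U) (ht : hg1201E_M19b_t.Mem t)
    (htp : hg1201E_M19b_tp.Mem tp) (hn : hg1201E_M19b_n.Mem n) : boxHg1201E_M19b.Mem (oneBandPointE U t tp n) := by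
  have hU' := (Entry.mem_ofEnds_iff _ _ _ _ _).1 hU
  have ht' := (Entry.mem_ofEnds_iff _ _ _ _ _).1 ht
  push_cast at hU' ht'
  exact oneBandPointE_mem_boxHg1201E_M19b_iff.2 ⟨hg1201E_Ut_mem_M19b_U ⟨by linarith [hU'.1], hU'.2⟩ ht', htp, hn, ht⟩

/-- **M19 column (p = 0.16) twins**: the v1.13 ladder lands in `boxHg1201E_M19uR`, the v1.8 ladder in the box of record `boxHg1201E_M19` (`n ∈ [4/5, 22/25]`).
[folklore] -/
theorem oneBandPointE_mem_boxHg1201E_M19_columns_of_ladder {U t tp n : ℝ} (ht : hg1201E_M19_t.Mem t) (htp : hg1201E_M19_tp.Mem tp)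
    (hn : hg1201E_M19_n.Mem n) :
    (hg1201U_litHullRu.Mem U → boxHg1201E_M19uR.Mem (oneBandPointE U t tp n)) ∧
      (hg1201U_litHullV18.Mem U → boxHg1201E_M19.Mem (oneBandPointE U t tp n)) := by
  have ht' := (Entry.mem_ofEnds_iff _ _ _ _ _).1 ht
  have htp' := (Entry.mem_ofEnds_iff _ _ _ _ _).1 htp
  have hn' := (Entry.mem_ofEnds_iff _ _ _ _ _).1 hn
  push_cast at ht' htp' hn'
  refine ⟨fun hU => ?_, fun hU => ?_⟩
  · have hU' := (Entry.mem_ofEnds_iff _ _ _ _ _).1 hU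
    push_cast at hU'
    have hq := (Entry.mem_ofEnds_iff _ _ _ _ _).1 (hg1201E_Ut_mem_uR_U (U := U) (t := t) ⟨by linarith [hU'.1], hU'.2⟩ ht').1
    push_cast at hq
    exact oneBandPointE_mem_boxHg1201E_M19uR_iff.2 ⟨hq, htp', hn', ht'⟩
  · have hU' := (Entry.mem_ofEnds_iff _ _ _ _ _).1 hU
    push_cast at hU'
    exact oneBandPointE_mem_boxHg1201E_M19_iff.2 ⟨hg1201E_Ut_mem_M19_U ⟨by linarith [hU'.1], hU'.2⟩ ht', htp, hn, ht⟩

/-- Every NAMED member of part 1's list is in the v1.9 hull (real form), and every member other than mRPA@QSGW in the v1.8 hull. [folklore] -/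
theorem hg1201U_member_mem_hulls {m : ℚ} (hm : m ∈ hg1201U_members) :
    hg1201U_litHullRu.Mem (m : ℝ) ∧ (m ≠ hg1201U_sakakibara2017_mRPA_QSGW → hg1201U_litHullV18.Mem (m : ℝ)) := by
  refine ⟨(Entry.mem_ofEnds_iff _ _ _ _ _).2 ⟨(Rat.cast_le (K := ℝ)).mpr (hg1201U_members_mem_litHullRu m hm).1,
    (Rat.cast_le (K := ℝ)).mpr (hg1201U_members_mem_litHullRu m hm).2⟩, fun hne => ?_⟩
  exact (Entry.mem_ofEnds_iff _ _ _ _ _).2 ⟨(Rat.cast_le (K := ℝ)).mpr (hg1201U_members_mem_litHullV18 m hm hne).1,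
    (Rat.cast_le (K := ℝ)).mpr (hg1201U_members_mem_litHullV18 m hm hne).2⟩

/-- **Member form**: each of the 16 admitted `U` determinations, over the whole `t_eff` / `t′/t_eff` / `n` entries, is a point of `boxHg1201E_M19buR`; each of the
15 v1.8 ones a point of the box of record `boxHg1201E_M19b`. [folklore] -/
theorem hg1201U_members_land {m : ℚ} (hm : m ∈ hg1201U_members) {t tp n : ℝ} (ht : hg1201E_M19b_t.Mem t) (htp : hg1201E_M19b_tp.Mem tp)
    (hn : hg1201E_M19b_n.Mem n) :
    boxHg1201E_M19buR.Mem (oneBandPointE m t tp n) ∧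
      (m ≠ hg1201U_sakakibara2017_mRPA_QSGW → boxHg1201E_M19b.Mem (oneBandPointE m t tp n)) :=
  ⟨oneBandPointE_mem_boxHg1201E_M19buR_of_ladder (hg1201U_member_mem_hulls hm).1 ht htp hn,
    fun hne => oneBandPointE_mem_boxHg1201E_M19b_of_ladder ((hg1201U_member_mem_hulls hm).2 hne) ht htp hn⟩

/-- **The R-u member `5.2` eV lands in the BOX OF RECORD iff `t_eff ≥ 13/22`** (`5.2/t ≤ 44/5 ⇔ t ≥ 26/44 = 0.5909…`): on `t_eff ∈ [1/2, 13/22)` its rung is in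
`boxHg1201E_M19buR` ONLY (the third slab `(44/5, 52/5]`, part 2 §W3) — the typed reason a word for the whole ladder needs the v1.13 box or unc-2's three slabs.
[folklore] -/
theorem hg1201E_RuRung_mem_M19b_iff {t tp n : ℝ} (ht : hg1201E_M19b_t.Mem t) (htp : hg1201E_M19b_tp.Mem tp) (hn : hg1201E_M19b_n.Mem n) :
    (boxHg1201E_M19b.Mem (oneBandPointE (hg1201U_sakakibara2017_mRPA_QSGW : ℝ) t tp n) ↔ (13 / 22 : ℝ) ≤ t) ∧
      boxHg1201E_M19buR.Mem (oneBandPointE (hg1201U_sakakibara2017_mRPA_QSGW : ℝ) t tp n) := by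
  have ht' := (Entry.mem_ofEnds_iff _ _ _ _ _).1 ht
  have htp' := (Entry.mem_ofEnds_iff _ _ _ _ _).1 htp
  have hn' := (Entry.mem_ofEnds_iff _ _ _ _ _).1 hn
  push_cast at ht' htp' hn'
  have ht0 : (0 : ℝ) < t := by linarith [ht'.1]
  have hm : ((hg1201U_sakakibara2017_mRPA_QSGW : ℚ) : ℝ) = 26 / 5 := by norm_num [hg1201U_sakakibara2017_mRPA_QSGW]
  refine ⟨?_, (hg1201U_members_land (by simp [hg1201U_members]) ht htp hn).1⟩
  rw [hm, oneBandPointE_mem_boxHg1201E_M19b_iff']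
  constructor
  · rintro ⟨⟨-, h2⟩, -, -, -⟩
    rw [div_le_iff₀ ht0] at h2
    linarith
  · intro h13
    refine ⟨⟨?_, ?_⟩, htp', hn', ht'⟩
    · rw [le_div_iff₀ ht0]; linarith [ht'.2]
    · rw [div_le_iff₀ ht0]; linarith

/-- **ALL THREE LADDERS AT ONCE (p = ⅛ column, box of record)**: every v1.8 `U` member over every one of unc-2's own-column `t_eff` refits `hg1201E_tMembers i`,
`i < 4` (`0.543, 0.556, 0.532, 0.548` eV), at every one of unc-3's admitted `t′/t_eff` members `hg1201E_P0dop_tp_members` and every filling of the entry —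
in particular the ARPES Luttinger count `[0.869, 0.893]` (unc-2 `hg1201ARPES_luttinger_filling`) — is a point of `boxHg1201E_M19b`; with the R-u member too, of
`boxHg1201E_M19buR`. [folklore] -/
theorem hg1201E_threeLadders_land_in_M19b {m : ℚ} (hm : m ∈ hg1201U_members) (i : Fin 8) (hi : i.val < 4) {s : ℚ}
    (hs : s ∈ hg1201E_P0dop_tp_members) {n : ℝ} (hn : hg1201E_M19b_n.Mem n) :
    boxHg1201E_M19buR.Mem (oneBandPointE m (hg1201E_tMembers i) s n) ∧
      (m ≠ hg1201U_sakakibara2017_mRPA_QSGW → boxHg1201E_M19b.Mem (oneBandPointE m (hg1201E_tMembers i) s n)) := by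
  have hti := hg1201E_tMembers_hulls.2.1 i hi
  have ht : hg1201E_M19b_t.Mem ((hg1201E_tMembers i : ℚ) : ℝ) := by
    refine (Entry.mem_ofEnds_iff _ _ _ _ _).2 ⟨(Rat.cast_le (K := ℝ)).mpr ?_, (Rat.cast_le (K := ℝ)).mpr ?_⟩
    · linarith [hti.1]
    · linarith [hti.2]
  exact hg1201U_members_land hm ht (hg1201E_P0dop_tp_members_mem_printed s hs).2 hn

/-- The ARPES-located filling slice lies in the M19b filling entry (real form of unc-2's inclusion), so its rungs are covered by the theorems above. [folklore] -/
theorem hg1201E_nARPES_mem_M19b_n {n : ℝ} (hn : hg1201E_nARPES.Mem n) : hg1201E_M19b_n.Mem n :=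
  Entry.mem_ofEnds_mono (by norm_num) (by norm_num) hn

/-! ## §L2 @10 GPa: the ladder lands in the double re-issue `boxHg1201E_M19P10uRnR`; the box of record misses one rung -/

/-- **An object-E point in `boxHg1201E_M19P10uRnR`, unfolded**: `U/t ∈ [3, 51/5]`, `t′/t ∈ [−49/100, −7/20]`, `n ∈ [79/100, 22/25]`, `t ∈ [51/100, 17/25]`. [folklore] -/
theorem oneBandPointE_mem_boxHg1201E_M19P10uRnR_iff {U t tp n : ℝ} :
    boxHg1201E_M19P10uRnR.Mem (oneBandPointE U t tp n) ↔
      ((3 : ℝ) ≤ U / t ∧ U / t ≤ 51 / 5) ∧ ((-49 / 100 : ℝ) ≤ tp ∧ tp ≤ -7 / 20) ∧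
      ((79 / 100 : ℝ) ≤ n ∧ n ≤ 22 / 25) ∧ ((51 / 100 : ℝ) ≤ t ∧ t ≤ 17 / 25) := by
  rw [boxHg1201E_M19P10uRnR_mem_iff]
  simp only [oneBandPointE_apply_UOverT, oneBandPointE_apply_tpOverT, oneBandPointE_apply_filling, oneBandPointE_apply_tEV,
    oneBandPointE_apply_tppOverT, and_true]

/-- **THE @10 LADDER LANDS IN THE DOUBLE RE-ISSUE**: every `U ∈ [2.15, 5.2]` eV over every `t_eff @10 ∈ [51/100, 17/25]` eV (`U/t ∈ [3.16…, 10.196…] ⊆ [3, 51/5]`,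
part 1's `hg1201E_Ut_mem_P10uR_U`), at every `t′/t ∈ [−49/100, −7/20]`, `n ∈ [79/100, 22/25]` (unc-2's `hg1201E_nP10R`), is a point of `boxHg1201E_M19P10uRnR`.
[folklore] -/
theorem oneBandPointE_mem_boxHg1201E_M19P10uRnR_of_ladder {U t tp n : ℝ} (hU : hg1201U_litHullRu.Mem U) (ht : hg1201E_M19P10_t.Mem t)
    (htp : hg1201E_M19P10_tp.Mem tp) (hn : hg1201E_nP10R.Mem n) : boxHg1201E_M19P10uRnR.Mem (oneBandPointE U t tp n) := by
  have hU' := (Entry.mem_ofEnds_iff _ _ _ _ _).1 hU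
  have ht' := (Entry.mem_ofEnds_iff _ _ _ _ _).1 ht
  have htp' := (Entry.mem_ofEnds_iff _ _ _ _ _).1 htp
  have hn' := (Entry.mem_ofEnds_iff _ _ _ _ _).1 hn
  push_cast at hU' ht' htp' hn'
  have hq := (Entry.mem_ofEnds_iff _ _ _ _ _).1 (hg1201E_Ut_mem_P10uR_U (U := U) (t := t) ⟨by linarith [hU'.1], hU'.2⟩ ht')
  push_cast at hq
  exact oneBandPointE_mem_boxHg1201E_M19P10uRnR_iff.2 ⟨hq, htp', hn', ht'⟩

/-- **unc-2's @10 `t_eff` members × the certified INFL-P factor are rungs too**: for `m ∈ [0.581, 0.606]` eV and `|x| ≤ 0.038`, `t = m·eˣ ∈ [51/100, 17/25]`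
(`hg1201E_tP10_inflP_mem_entry`), so every `U ∈ [2.15, 5.2]` over it lands in `boxHg1201E_M19P10uRnR`. [folklore] -/
theorem oneBandPointE_mem_boxHg1201E_M19P10uRnR_of_inflP {U m x tp n : ℝ} (hU : hg1201U_litHullRu.Mem U)
    (hm : m ∈ Set.Icc (581 / 1000 : ℝ) (303 / 500)) (hx : x ∈ Set.Icc (-(19 / 500) : ℝ) (19 / 500)) (htp : hg1201E_M19P10_tp.Mem tp)
    (hn : hg1201E_nP10R.Mem n) : boxHg1201E_M19P10uRnR.Mem (oneBandPointE U (m * Real.exp x) tp n) := by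
  have ht := hg1201E_tP10_inflP_mem_entry hm hx
  refine oneBandPointE_mem_boxHg1201E_M19P10uRnR_of_ladder hU ?_ htp hn
  refine (Entry.mem_ofEnds_iff _ _ _ _ _).2 ?_
  push_cast
  exact ht

/-- **The @10 BOX OF RECORD MISSES A RUNG**: the cGW member `4.37` eV over the @10 `t_eff` low end `0.51` eV (`U/t = 8.569 > 17/2`) is NOT a point of
`boxHg1201E_M19P10` (part 1's finding `hg1201E_Ut_P10_corner_not_mem`, point form), while it IS a point of the double re-issue — for any `t′/t`, `n` of the rows.
Numbers only; the row is the lead's. [folklore] -/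
theorem hg1201E_cGWRungP10_not_mem_record {tp n : ℝ} (htp : hg1201E_M19P10_tp.Mem tp) (hn : hg1201E_nP10R.Mem n) :
    ¬ boxHg1201E_M19P10.Mem (oneBandPointE (hg1201U_hirayama2018_cGW : ℝ) (51 / 100) tp n) ∧
      boxHg1201E_M19P10uRnR.Mem (oneBandPointE (hg1201U_hirayama2018_cGW : ℝ) (51 / 100) tp n) := by
  have hm : ((hg1201U_hirayama2018_cGW : ℚ) : ℝ) = 437 / 100 := by norm_num [hg1201U_hirayama2018_cGW]
  refine ⟨fun h => hg1201E_Ut_P10_corner_not_mem ?_, ?_⟩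
  · have hU := h .UOverT hg1201E_M19P10_U rfl
    rw [oneBandPointE_apply_UOverT, hm] at hU
    exact hU
  · refine oneBandPointE_mem_boxHg1201E_M19P10uRnR_of_ladder (hg1201U_member_mem_hulls (by simp [hg1201U_members])).1 ?_ htp hn
    exact (Entry.mem_ofEnds_iff _ _ _ _ _).2 ⟨by norm_num, by norm_num⟩

/-- **Which members the @10 box of record DOES hold at every `t_eff @10`**: every member `m ≤ 4.029` (all but cGW `4.37` and mRPA@QSGW `5.2`) has its whole @10
image `m/t`, `t ∈ [51/100, 17/25]`, inside `[3, 17/2]` (`4.029/0.51 = 7.9`, `2.15/0.68 = 3.16`). [folklore] -/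
theorem hg1201E_membersP10_image_le_17o2 {m : ℚ} (hm : m ∈ hg1201U_members) (h1 : m ≠ hg1201U_hirayama2018_cGW)
    (h2 : m ≠ hg1201U_sakakibara2017_mRPA_QSGW) {t : ℝ} (ht : (51 / 100 : ℝ) ≤ t ∧ t ≤ 17 / 25) :
    (3 : ℝ) ≤ (m : ℝ) / t ∧ (m : ℝ) / t ≤ 17 / 2 := by
  have hb : (43 / 20 : ℚ) ≤ m ∧ m ≤ 4029 / 1000 := by
    simp only [hg1201U_members, List.mem_cons, List.mem_nil_iff, or_false] at hm
    rcases hm with rfl | rfl | rfl | rfl | rfl | rfl | rfl | rfl | rfl | rfl | rfl | rfl | rfl | rfl | rfl | rfl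
    all_goals first
      | exact absurd rfl h1
      | exact absurd rfl h2
      | (constructor <;> norm_num [hg1201U_jang2016, hg1201U_inhouseW26, hg1201U_teranishi2018, hg1201U_vucicevic2026, hg1201U_inhouseD20,
          hg1201U_nilsson2019, hg1201U_sakakibara2017_cRPA_QSGW, hg1201U_sakakibara2017_mRPA_LDA, hg1201U_hirayama2019_LRFB,
          hg1201U_moree2022_d01, hg1201U_moree2022_d00, hg1201U_moreeArita2024_d00, hg1201U_moreeArita2024_d01, hg1201U_moreeArita2024_d02])
  have hlo : ((43 / 20 : ℚ) : ℝ) ≤ (m : ℝ) := (Rat.cast_le (K := ℝ)).mpr hb.1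
  have hhi : (m : ℝ) ≤ ((4029 / 1000 : ℚ) : ℝ) := (Rat.cast_le (K := ℝ)).mpr hb.2
  push_cast at hlo hhi
  have ht0 : (0 : ℝ) < t := by linarith [ht.1]
  constructor
  · rw [le_div_iff₀ ht0]; linarith [ht.2]
  · rw [div_le_iff₀ ht0]; linarith [ht.1]

/-- **Both columns' ladders land in unc-3's CURRENT PRESSURE HULL `boxHg1201E_M19PHullNR`** (via the refinements of record), and **the double re-issue refines it**
(`boxHg1201E_M19P10uRnR ⊆ boxHg1201E_M19PHullNR`: unc-3's generic `withEntry_filling_P10_refines_PHullNR` at unc-2's `hg1201E_nP10R`, one `exact`). [folklore] -/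
theorem boxHg1201E_M19P10uRnR_refines_PHullNR :
    boxHg1201E_M19P10uRnR.Refines boxHg1201E_M19PHullNR ∧ boxHg1201E_M19uR.Refines boxHg1201E_M19PHullNR :=
  ⟨(withEntry_filling_P10_refines_PHullNR (e := hg1201E_nP10R) fun _ hx => hx).2, refines_PHullNR_family.2.2.2.2.1⟩

/-- A word on the current pressure hull holds on the double re-issue (and, part 3 §P2, on the three boxes it covers). [folklore] -/
theorem holdsOn_uRnR_of_holdsOn_PHullNR {W : (OneBandCoord → ℝ) → Prop} (h : HoldsOn W boxHg1201E_M19PHullNR) :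
    HoldsOn W boxHg1201E_M19P10uRnR :=
  h.of_refines boxHg1201E_M19P10uRnR_refines_PHullNR.1

end Summit.Ventures.CertifiedManyBodySolver.Downfold

end
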